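import Mathlib
import HarnessLib

/-!
# Derivative algebra for the tilted, normalised polynomial

For `P ∈ ℂ[X]` with `P(1) ≠ 0`, a real tilt `a` and `F(z) = P(z) e^{-a(z-1)} / P(1)`
(so `F(1) = 1`), the second logarithmic Taylor datum of `F` at `1` does not see the tilt:
`F''(1) - F'(1)² = P''(1)/P(1) - (P'(1)/P(1))²`.

Indeed `F' = (P' - aP) e^{-a(z-1)} / P(1)` and `F'' = (P'' - 2aP' + a²P) e^{-a(z-1)} / P(1)`,
and at `z = 1` the `a`-terms cancel.  We compute `deriv` of `z ↦ Q(z) e^{-a(z-1)} / c` globally as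
a function (`deriv_tilted`: it is the same shape with `Q` replaced by `Q' - a • Q`), apply it
twice (`iteratedDeriv 2 = deriv ∘ deriv`) and finish with `field_simp; ring`.
-/

noncomputable section

namespace Summit.Parity.BatemanHorn.Cruxes.SystemMomentDeficit.SmallCircle

open Polynomial

/-- The tilt factor `E(w) = exp (-(a (w - 1)))` has derivative `-a E(z)` at `z`. -/
theorem hasDerivAt_tilt (a z : ℂ) :
    HasDerivAt (fun w : ℂ => Complex.exp (-(a * (w - 1))))
      (-a * Complex.exp (-(a * (z - 1)))) z := by
  have h1 : HasDerivAt (fun w : ℂ => -(a * (w - 1))) (-(a * 1)) z := by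
    simpa only [neg_mul] using ((hasDerivAt_id' z).sub_const 1).const_mul (-a)
  exact h1.cexp.congr_deriv (by ring)

/-- First derivative of `w ↦ Q(w) E(w) / c` at `z`: it is `(Q' - a • Q)(z) E(z) / c`. -/
theorem hasDerivAt_tilted (Q : ℂ[X]) (a c z : ℂ) :
    HasDerivAt (fun w : ℂ => Q.eval w * Complex.exp (-(a * (w - 1))) / c)
      ((derivative Q - a • Q).eval z * Complex.exp (-(a * (z - 1))) / c) z := by
  have h := ((Q.hasDerivAt z).mul (hasDerivAt_tilt a z)).div_const c
  refine h.congr_deriv ?_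
  simp only [eval_sub, eval_smul, smul_eq_mul]
  ring

/-- The derivative of `w ↦ Q(w) E(w) / c`, as a function: the same shape with `Q` replaced by
`Q' - a • Q` (the tilt is log-linear). -/
theorem deriv_tilted (Q : ℂ[X]) (a c : ℂ) :
    deriv (fun w : ℂ => Q.eval w * Complex.exp (-(a * (w - 1))) / c) =
      fun w : ℂ => (derivative Q - a • Q).eval w * Complex.exp (-(a * (w - 1))) / c :=
  funext fun z => (hasDerivAt_tilted Q a c z).deriv

/-- **Derivative algebra for the tilted, normalised polynomial.**  For `P(1) ≠ 0` and
`F(z) = P(z)e^{−a(z−1)}/P(1)`: `F''(1) − F'(1)² = P''(1)/P(1) − (P'(1)/P(1))²` (the tilt is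
log-linear: `F' = (P' − aP)e^{−a(z−1)}/P(1)`, `F'' = (P'' − 2aP' + a²P)e^{−a(z−1)}/P(1)`, and at
`z = 1` the `a`-terms cancel). [folklore] -/
theorem stub_logDerivPolynomial :
    ∀ (P : Polynomial ℂ) (a : ℝ), P.eval 1 ≠ 0 →
      iteratedDeriv 2 (fun z : ℂ => P.eval z * Complex.exp (-((a : ℂ) * (z - 1))) / P.eval 1) 1 -
          (deriv (fun z : ℂ => P.eval z * Complex.exp (-((a : ℂ) * (z - 1))) / P.eval 1) 1) ^ 2 =
        (derivative (derivative P)).eval 1 / P.eval 1 - ((derivative P).eval 1 / P.eval 1) ^ 2 := by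
  intro P a hP1
  rw [iteratedDeriv_succ, iteratedDeriv_one, deriv_tilted, deriv_tilted]
  simp only [sub_self, mul_zero, neg_zero, Complex.exp_zero, mul_one, eval_sub, eval_smul,
    smul_eq_mul, derivative_sub, derivative_smul]
  field_simp
  ring

end Summit.Parity.BatemanHorn.Cruxes.SystemMomentDeficit.SmallCircle

end
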